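import Summits.Ventures.CertifiedArithmetic.LowPrec.SRMonotone
import Summits.Ventures.CertifiedArithmetic.LowPrec.SRTreeEnvelopes
import Summits.Ventures.CertifiedArithmetic.LowPrec.SRCertificatesFP4
import HarnessLib

/-!
# Stochastic rounding into a finite format, XX: the sign of the saturation bias

HONEST FRAMING: certified error envelopes and provably optimal rounding/accumulation schemes for
low-precision formats under stated cost models; every table by two implementations; no hardware or
vendor claims.

Venture CertifiedArithmetic / lowprec, SR slice (gen5). File VII proved `E ŝ_T = Σ_T + treeBias F T`
for every reduction tree (saturation is the ONLY source of bias of SR summation into a finite format)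
and file XI bounded `|treeBias| ≤ 2R·P(sat)`. Here the SIGN:

* `clamp_le_self_of_mem` / `self_le_clamp_of_mem` — clamping moves a value DOWN whenever some element
  of `F` lies below it, UP whenever some element lies above it;
* `AboveT F lo T` (`BelowT F hi T`) — on every branch every node's pre-rounding value is `≥ lo`
  (`≤ hi`): a ONE-SIDED version of file VII's `NoSatT`;
* `treeBias_nonpos_of_aboveT` — if no branch can saturate DOWNWARD then `treeBias ≤ 0`, i.e.
  **`E ŝ_T ≤ Σ_T`** (`treeMean_le_exact_of_aboveT`); dually `treeBias_nonneg_of_belowT`,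
  `exact_le_treeMean_of_belowT`;
* `allOut_nonneg` / `aboveT_of_nonneg` — NONNEGATIVE DATA in a format containing `0` never produce a
  negative partial result, hence **saturating SR summation of nonnegative data under-estimates in the
  mean, in every order**: `treeMean_le_exact_of_nonneg`, `treeBias_nonpos_of_nonneg` (and the mirror
  statements for nonpositive data).

This is the sign of the `bias` column of `certs/sr/gen5/EXACT_cases_{A,B}.csv` (all 44 named vectors are
nonnegative; every nonzero bias there is negative, e.g. E4M3 saw8 sequential n = 256: −7.12…).
Kernel instance (E2M1): the row `((4 ⊕ 3/2) ⊕ 3/2)` of file XI has bias `−9/8 < 0`.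
-/

namespace Summit.Ventures.CertifiedArithmetic.LowPrec.SR

open Literature.ComputerArithmetic.ConnollyHighamMary2021 Finset STree

variable {K : Type*} [Field K] [LinearOrder K] [IsStrictOrderedRing K]

/-! ### Clamping is one-sided -/

omit [Field K] [IsStrictOrderedRing K] in
/-- If some element of `F` is `≤ c` then clamping does not increase `c`. -/
theorem clamp_le_self_of_mem {F : Finset K} {x c : K} (hx : x ∈ F) (hxc : x ≤ c) : clamp F c ≤ c := by
  have hF : F.Nonempty := ⟨x, hx⟩
  unfold clamp; rw [dif_pos hF]
  exact max_le (le_trans (F.min'_le x hx) hxc) (min_le_left _ _)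

omit [Field K] [IsStrictOrderedRing K] in
/-- If some element of `F` is `≥ c` then clamping does not decrease `c`. -/
theorem self_le_clamp_of_mem {F : Finset K} {x c : K} (hx : x ∈ F) (hcx : c ≤ x) : c ≤ clamp F c := by
  have hF : F.Nonempty := ⟨x, hx⟩
  unfold clamp; rw [dif_pos hF]
  exact le_trans (le_min le_rfl (le_trans hcx (F.le_max' x hx))) (le_max_right _ _)

omit [Field K] [IsStrictOrderedRing K] in
/-- A representable lower bound of `c` is a lower bound of both SR candidates. -/
theorem le_dn_of_mem {F : Finset K} {x c : K} (hx : x ∈ F) (hxc : x ≤ c) : x ≤ dn F c := by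
  have hF : F.Nonempty := ⟨x, hx⟩
  unfold dn
  refine le_roundDown_of_mem hx ?_
  unfold clamp; rw [dif_pos hF]
  exact le_max_of_le_right (le_min hxc (F.le_max' x hx))

omit [Field K] [IsStrictOrderedRing K] in
/-- A representable upper bound of `c` is an upper bound of both SR candidates. -/
theorem up_le_of_mem {F : Finset K} {x c : K} (hx : x ∈ F) (hcx : c ≤ x) : up F c ≤ x := by
  have hF : F.Nonempty := ⟨x, hx⟩
  unfold up
  refine roundUp_le_of_mem hx ?_
  unfold clamp; rw [dif_pos hF]
  exact max_le (F.min'_le x hx) (le_trans (min_le_left _ _) hcx)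

/-! ### One-sided no-saturation predicates and the sign of the bias -/

/-- `AboveT F lo T`: on every branch, every node's pre-rounding value `a + b` is `≥ lo`. -/
def AboveT (F : Finset K) (lo : K) : STree K → Prop
  | .leaf _ => True
  | .node l r => AboveT F lo l ∧ AboveT F lo r ∧ AllOut F l (fun a => AllOut F r (fun b => lo ≤ a + b))

/-- `BelowT F hi T`: on every branch, every node's pre-rounding value `a + b` is `≤ hi`. -/
def BelowT (F : Finset K) (hi : K) : STree K → Prop
  | .leaf _ => True
  | .node l r => BelowT F hi l ∧ BelowT F hi r ∧ AllOut F l (fun a => AllOut F r (fun b => a + b ≤ hi))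

/-- **No downward saturation ⇒ the saturation bias is `≤ 0`.** -/
theorem treeBias_nonpos_of_aboveT {F : Finset K} {lo : K} (hlo : lo ∈ F) :
    ∀ T : STree K, AboveT F lo T → treeBias F T ≤ 0
  | .leaf _, _ => le_rfl
  | .node l r, ⟨hl, hr, hh⟩ => by
      simp only [treeBias]
      have h3 : treeExp F l (fun a => treeExp F r (fun b => clamp F (a + b) - (a + b))) ≤ 0 :=
        treeExp_le_of_allOut F l (allOut_mono F l (fun a ha =>
          treeExp_le_of_allOut F r (allOut_mono F r
            (fun b hb => sub_nonpos.mpr (clamp_le_self_of_mem hlo hb)) ha)) hh)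
      have h1 := treeBias_nonpos_of_aboveT hlo l hl
      have h2 := treeBias_nonpos_of_aboveT hlo r hr
      linarith

/-- **No upward saturation ⇒ the saturation bias is `≥ 0`.** -/
theorem treeBias_nonneg_of_belowT {F : Finset K} {hi : K} (hhi : hi ∈ F) :
    ∀ T : STree K, BelowT F hi T → 0 ≤ treeBias F T
  | .leaf _, _ => le_rfl
  | .node l r, ⟨hl, hr, hh⟩ => by
      simp only [treeBias]
      have h3 : 0 ≤ treeExp F l (fun a => treeExp F r (fun b => clamp F (a + b) - (a + b))) :=
        le_treeExp_of_allOut F l (allOut_mono F l (fun a ha =>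
          le_treeExp_of_allOut F r (allOut_mono F r
            (fun b hb => sub_nonneg.mpr (self_le_clamp_of_mem hhi hb)) ha)) hh)
      have h1 := treeBias_nonneg_of_belowT hhi l hl
      have h2 := treeBias_nonneg_of_belowT hhi r hr
      linarith

/-- `E ŝ_T ≤ Σ_T` when no branch saturates downward. -/
theorem treeMean_le_exact_of_aboveT {F : Finset K} {lo : K} (hlo : lo ∈ F) {T : STree K}
    (h : AboveT F lo T) : treeExp F T (fun v => v) ≤ T.exact := by
  rw [treeExp_id]; linarith [treeBias_nonpos_of_aboveT hlo T h]

/-- `Σ_T ≤ E ŝ_T` when no branch saturates upward. -/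
theorem exact_le_treeMean_of_belowT {F : Finset K} {hi : K} (hhi : hi ∈ F) {T : STree K}
    (h : BelowT F hi T) : T.exact ≤ treeExp F T (fun v => v) := by
  rw [treeExp_id]; linarith [treeBias_nonneg_of_belowT hhi T h]

/-! ### Nonnegative (nonpositive) data -/

/-- Nonnegative data in a format containing `0` never produce a negative partial result. -/
theorem allOut_nonneg {F : Finset K} (h0 : (0 : K) ∈ F) :
    ∀ T : STree K, LeafLE (T.map fun _ => (0 : K)) T → AllOut F T (fun v => 0 ≤ v)
  | .leaf x, h => by simp only [STree.map, LeafLE] at h; exact h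
  | .node l r, h => by
      simp only [STree.map, LeafLE] at h
      simp only [AllOut]
      refine allOut_mono F l (fun a ha => ?_) (allOut_nonneg h0 l h.1)
      refine allOut_mono F r (fun b hb => ?_) (allOut_nonneg h0 r h.2)
      have hd : 0 ≤ dn F (a + b) := le_dn_of_mem h0 (add_nonneg ha hb)
      exact ⟨le_trans hd (roundDown_le_roundUp F _), hd⟩

/-- Nonpositive data in a format containing `0` never produce a positive partial result. -/
theorem allOut_nonpos {F : Finset K} (h0 : (0 : K) ∈ F) :
    ∀ T : STree K, LeafLE T (T.map fun _ => (0 : K)) → AllOut F T (fun v => v ≤ 0)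
  | .leaf x, h => by simp only [STree.map, LeafLE] at h; exact h
  | .node l r, h => by
      simp only [STree.map, LeafLE] at h
      simp only [AllOut]
      refine allOut_mono F l (fun a ha => ?_) (allOut_nonpos h0 l h.1)
      refine allOut_mono F r (fun b hb => ?_) (allOut_nonpos h0 r h.2)
      have hu : up F (a + b) ≤ 0 := up_le_of_mem h0 (add_nonpos ha hb)
      exact ⟨hu, le_trans (roundDown_le_roundUp F _) hu⟩

/-- Nonnegative data cannot saturate downward (`AboveT F 0`). -/
theorem aboveT_of_nonneg {F : Finset K} (h0 : (0 : K) ∈ F) :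
    ∀ T : STree K, LeafLE (T.map fun _ => (0 : K)) T → AboveT F 0 T
  | .leaf _, _ => trivial
  | .node l r, h => by
      simp only [STree.map, LeafLE] at h
      refine ⟨aboveT_of_nonneg h0 l h.1, aboveT_of_nonneg h0 r h.2, ?_⟩
      refine allOut_mono F l (fun a ha => ?_) (allOut_nonneg h0 l h.1)
      exact allOut_mono F r (fun b hb => add_nonneg ha hb) (allOut_nonneg h0 r h.2)

/-- Nonpositive data cannot saturate upward (`BelowT F 0`). -/
theorem belowT_of_nonpos {F : Finset K} (h0 : (0 : K) ∈ F) :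
    ∀ T : STree K, LeafLE T (T.map fun _ => (0 : K)) → BelowT F 0 T
  | .leaf _, _ => trivial
  | .node l r, h => by
      simp only [STree.map, LeafLE] at h
      refine ⟨belowT_of_nonpos h0 l h.1, belowT_of_nonpos h0 r h.2, ?_⟩
      refine allOut_mono F l (fun a ha => ?_) (allOut_nonpos h0 l h.1)
      exact allOut_mono F r (fun b hb => add_nonpos ha hb) (allOut_nonpos h0 r h.2)

/-- **Saturating SR summation of nonnegative data under-estimates in the mean, in every order**:
`E ŝ_T ≤ Σ_T` (equivalently `treeBias ≤ 0`) whenever `0 ∈ F` and all summands are `≥ 0`. -/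
theorem treeMean_le_exact_of_nonneg {F : Finset K} (h0 : (0 : K) ∈ F) {T : STree K}
    (hT : LeafLE (T.map fun _ => (0 : K)) T) : treeExp F T (fun v => v) ≤ T.exact :=
  treeMean_le_exact_of_aboveT h0 (aboveT_of_nonneg h0 T hT)

/-- The saturation bias of nonnegative data is `≤ 0`. -/
theorem treeBias_nonpos_of_nonneg {F : Finset K} (h0 : (0 : K) ∈ F) {T : STree K}
    (hT : LeafLE (T.map fun _ => (0 : K)) T) : treeBias F T ≤ 0 :=
  treeBias_nonpos_of_aboveT h0 T (aboveT_of_nonneg h0 T hT)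

/-- Mirror image: nonpositive data over-estimate in the mean (`Σ_T ≤ E ŝ_T`, `0 ≤ treeBias`). -/
theorem exact_le_treeMean_of_nonpos {F : Finset K} (h0 : (0 : K) ∈ F) {T : STree K}
    (hT : LeafLE T (T.map fun _ => (0 : K))) : T.exact ≤ treeExp F T (fun v => v) :=
  exact_le_treeMean_of_belowT h0 (belowT_of_nonpos h0 T hT)

/-! ### Kernel instance (E2M1) -/

namespace BiasSign
open FP4

/-- File XI's row `((4 ⊕ 3/2) ⊕ 3/2)` in E2M1 (exact sum 7 > maxRat 6): the bias is `−9/8 < 0`, as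
`treeBias_nonpos_of_nonneg` predicts (plain kernel evaluation). -/
theorem e2m1_row_bias :
    treeBias e2m1 (.node (.node (.leaf 4) (.leaf (3 / 2))) (.leaf (3 / 2))) = -9 / 8 := by
  decide +kernel

/-- The theorem applied: the E2M1 recursive SR sum of eight `1`s (exact sum 8 > maxRat 6, P(sat) = 7/8
by file XVIII) has mean `≤ 8` — obtained from `treeMean_le_exact_of_nonneg`, the two decidable side
conditions (`0 ∈ e2m1`, leaves `≥ 0`) discharged by the kernel. -/
theorem e2m1_comb8_mean_le :
    treeExp e2m1 (comb (fun _ => (1 : ℚ)) 1 7) (fun v => v) ≤ 8 := by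
  have h := treeMean_le_exact_of_nonneg (F := e2m1) (T := comb (fun _ => (1 : ℚ)) 1 7)
    (by decide +kernel) (by decide +kernel)
  have he : (comb (fun _ => (1 : ℚ)) 1 7).exact = 8 := by decide +kernel
  rwa [he] at h

end BiasSign

end Summit.Ventures.CertifiedArithmetic.LowPrec.SR
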